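import Literature.Probability.RandomPlanarGeometry.SAWIrreducibleBridgeSpanTwoSecondClassCount
import HarnessLib

/-!
# The second axis class of the span-two cell, III: the two binomial sums, the census law (L2′), and Amendment BC unconditionally

Topic `Literature/Probability/RandomPlanarGeometry` (sequel of `SAWIrreducibleBridgeSpanTwoSecondClass.lean` (rigidity and locality) and
`SAWIrreducibleBridgeSpanTwoSecondClassCount.lean` (the planted-skeleton count and ★★★ `axisClassCard_second_eq_skeleton_sums`:
`2F_{c,c+2}(c−3)/(c−3)! = C(n−2,2)·2^{n−2}·#skels(n) − 2^{n−3}·Σ_{skels(n)}(2(n−3) + bCount)`, `n = c + 1`); closes hypothesis `hF` of the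
tree's `SAWCountZdFourthCoefficient.exists_polynomial_largeForceCoeffZd_thirdCoeff_of_bridge_count` (a-p1 g21, after (L1))).

PRINTED CONTEXT (locators only; nothing quoted). Madras–Slade (1993) §4.2 eq. (4.2.20)–(4.2.22) p. 94 (the pulled large-force
expansion and its cost census), §1.2 p. 10 (the `1/d` expansion of `μ`), §1.1 eq. (1.1.8) p. 5. NOT IN PRINT (lane statements): everything
below; in particular the fourth symbol `[d^{k−3}] c_k^{(d)}` is a LANE law (Amendment BC), not a number from print.

THIS FILE (lane «pcv-sawmu», a-p1 g21; all PROVED, standard axioms; tool notion `prs` — not a notion in print):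
* the skeleton simplex: `prs g m` (pairs `1 ≤ p`, `p + g ≤ q ≤ m`), `card_prs` (`C(m+1−g, 2)`), `skels_succ`, ★ `card_skels`
  (`#skels(n) = C(n−2, 3)`), `skels_succ_filter_r_le`, `skels_succ_filter_two_le` (shift), `card_skels_filter_q` / `_r` (`C(n−3,2)`),
  `card_skels_filter_qr` (`n − 4`);
* the constrained lateral positions of one skeleton: `src_one`, `src_p_succ_eq_none_iff`, `src_q_succ_eq_none_iff`, `src_r_succ_eq_none_iff`,
  ★ `bCount_add_free` (`bCount + [p ≥ 2] + [¬(q = p+2 ∧ p ≥ 2)] + [¬(q = p+2 ∨ r = q+2)] + [r+1 ≤ n ∧ r ≠ q+2] = n − 3`);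
* the two sums: `cast_choose_three`, ★ `card_skels_cast` (`#skels(m+4) = (m+2)(m+1)m/6`), ★★ `sum_bCount_skels`
  (`Σ_{skels(m+4)} bCount = m²(m²−1)/6 + 2m² − m` = `1, 8, 27, 68, 145, …`);
* ★★★ `card_irreducibleBridges_spanTwo_secondClass` — THE CENSUS LAW (L2′): for `m ≥ 1`,
  `F_{m+3,m+5}(m) = m!·2^m·((m+3)⁵ − 12(m+3)⁴ + 59(m+3)³ − 162(m+3)² + 276(m+3) − 234)/6` (`= 2, 128, 4464, 127488, …`), verbatim the
  hypothesis `hF`;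
* ★★★ `exists_polynomial_largeForceCoeffZd_thirdCoeff_law` — AMENDMENT BC UNCONDITIONALLY: for every `k ≥ 3`, `c_k^{(d)}` is a polynomial
  in `d` of degree `k − 1` with `[d^{k−1}] = (−2)^{k−1}`, `[d^{k−2}] = (−1)^{k−1}2^{k−2}(k²−5k+7)`,
  `[d^{k−3}] = (−1)^{k−1}2^{k−3}(k−3)(k−4)(5k²−35k+56)/12`.
[cite: MadrasSlade1993, §4.2 eq. (4.2.20)–(4.2.22) (p. 94); §1.2 (p. 10); §1.1 eq. (1.1.8) p. 5]

Provenance: lane «pcv-sawmu», a-p1 g21 (2026-08-27).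
-/

noncomputable section

open Finset
open scoped BigOperators
open Literature.Probability.LatticeModels
open Literature.Probability.RandomPlanarGeometry.SAW
open Literature.Probability.Percolation

namespace Literature.Probability.RandomPlanarGeometry.SAW.Zd

namespace WordTypes

section SkeletonSums

/-! ### The two finite sums over skeletons: `#skels(n) = C(n−2,3)` and `Σ bCount` -/

/-- Pairs `1 ≤ p`, `p + g ≤ q ≤ m` (lane plumbing for the skeleton sums). [cite: MadrasSlade1993, §4.2 (p. 94); lane plumbing] -/
def prs (g m : ℕ) : Finset (ℕ × ℕ) :=
  (Finset.range (m + 1) ×ˢ Finset.range (m + 1)).filter fun x => 1 ≤ x.1 ∧ x.1 + g ≤ x.2 ∧ x.2 ≤ m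

/-- Membership in `prs`. [cite: MadrasSlade1993, §4.2 (p. 94); lane plumbing] -/
theorem mem_prs {g m : ℕ} {x : ℕ × ℕ} : x ∈ prs g m ↔ 1 ≤ x.1 ∧ x.1 + g ≤ x.2 ∧ x.2 ≤ m := by
  unfold prs
  simp only [Finset.mem_filter, Finset.mem_product, Finset.mem_range]
  constructor
  · rintro ⟨-, h⟩; exact h
  · intro h; exact ⟨⟨by omega, by omega⟩, h⟩

/-- `#prs g m = C(m + 1 − g, 2)` (`g ≥ 1`). [cite: MadrasSlade1993, §4.2 (p. 94); lane plumbing] -/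
theorem card_prs {g : ℕ} (hg : 1 ≤ g) : ∀ m, (prs g m).card = (m + 1 - g).choose 2 := by
  intro m
  induction m with
  | zero =>
    have h0 : prs g 0 = ∅ := by
      rw [Finset.eq_empty_iff_forall_notMem]; intro x hx; rw [mem_prs] at hx; omega
    rw [h0, Finset.card_empty, show 0 + 1 - g = 0 by omega]; rfl
  | succ m ih =>
    have hdec : prs g (m + 1) = prs g m ∪ (Finset.Icc 1 (m + 1 - g)).image (fun p => (p, m + 1)) := by
      ext ⟨a, b⟩
      simp only [Finset.mem_union, mem_prs, Finset.mem_image, Finset.mem_Icc, Prod.mk.injEq]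
      constructor
      · rintro ⟨h1, h2, h3⟩
        rcases Nat.lt_or_ge b (m + 1) with hb | hb
        · exact Or.inl ⟨h1, h2, by omega⟩
        · exact Or.inr ⟨a, ⟨h1, by omega⟩, rfl, by omega⟩
      · rintro (⟨h1, h2, h3⟩ | ⟨a', ⟨h1, h2⟩, rfl, rfl⟩)
        · exact ⟨h1, h2, by omega⟩
        · refine ⟨h1, ?_, le_rfl⟩
          rcases Nat.lt_or_ge m g with hmg | hmg
          · omega
          · omega
    have hdisj : Disjoint (prs g m) ((Finset.Icc 1 (m + 1 - g)).image (fun p => (p, m + 1))) := by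
      rw [Finset.disjoint_left]
      intro x hx hx'
      rw [mem_prs] at hx
      simp only [Finset.mem_image, Finset.mem_Icc] at hx'
      obtain ⟨a, -, rfl⟩ := hx'
      simp at hx
    rw [hdec, Finset.card_union_of_disjoint hdisj, ih, Finset.card_image_of_injective _ (fun a b h => by simpa using h),
      Nat.card_Icc]
    rcases Nat.lt_or_ge m g with hmg | hmg
    · rw [show m + 1 - g = 0 by omega]
      rcases Nat.eq_or_lt_of_le (show m + 1 + 1 - g ≤ 1 by omega) with h1 | h1
      · rw [h1]; rfl
      · rw [show m + 1 + 1 - g = 0 by omega]; rfl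
    · rw [show m + 1 + 1 - g = (m + 1 - g) + 1 by omega, Nat.choose_succ_succ', Nat.choose_one_right]
      simp only [Nat.reduceAdd]
      omega


/-- There are no skeletons of length `≤ 4`. [cite: MadrasSlade1993, §4.2 (p. 94); lane plumbing] -/
theorem skels_eq_empty {n : ℕ} (hn : n ≤ 4) : skels n = ∅ := by
  rw [Finset.eq_empty_iff_forall_notMem]; intro x hx; rw [mem_skels] at hx; omega

/-- `skels (n+1)` = `skels n` plus the skeletons with `r = n + 1`. [cite: MadrasSlade1993, §4.2 (p. 94); lane plumbing] -/
theorem skels_succ (n : ℕ) :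
    skels (n + 1) = skels n ∪ (prs 2 (n - 1)).image (fun y => (y.1, y.2, n + 1)) := by
  ext ⟨a, b, c⟩
  simp only [Finset.mem_union, mem_skels, Finset.mem_image, mem_prs, Prod.mk.injEq]
  constructor
  · rintro ⟨h1, h2, h3, h4⟩
    rcases Nat.lt_or_ge c (n + 1) with hc | hc
    · exact Or.inl ⟨h1, h2, h3, by omega⟩
    · exact Or.inr ⟨(a, b), ⟨h1, h2, by omega⟩, rfl, rfl, by omega⟩
  · rintro (⟨h1, h2, h3, h4⟩ | ⟨y, ⟨h1, h2, h3⟩, rfl, rfl, rfl⟩)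
    · exact ⟨h1, h2, h3, by omega⟩
    · exact ⟨h1, h2, by omega, le_rfl⟩

/-- ★ `#skels(n) = C(n − 2, 3)`. [cite: MadrasSlade1993, §4.2 (p. 94); lane lemma] -/
theorem card_skels : ∀ n, (skels n).card = (n - 2).choose 3 := by
  intro n
  induction n with
  | zero => rw [skels_eq_empty (by omega)]; rfl
  | succ n ih =>
    have hdisj : Disjoint (skels n) ((prs 2 (n - 1)).image (fun y => (y.1, y.2, n + 1))) := by
      rw [Finset.disjoint_left]
      intro x hx hx'
      rw [mem_skels] at hx
      simp only [Finset.mem_image] at hx'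
      obtain ⟨y, -, rfl⟩ := hx'
      simp at hx
    have hinj : Function.Injective (fun y : ℕ × ℕ => (y.1, y.2, n + 1)) := by
      intro y y' h; simp only [Prod.mk.injEq] at h; exact Prod.ext h.1 h.2.1
    rw [skels_succ, Finset.card_union_of_disjoint hdisj, ih, Finset.card_image_of_injective _ hinj, card_prs (by omega),
      show n - 1 + 1 - 2 = n - 2 by omega]
    rcases Nat.lt_or_ge n 2 with hn | hn
    · rw [show n - 2 = 0 by omega, show n + 1 - 2 = 0 by omega]; rfl
    · obtain ⟨k, rfl⟩ : ∃ k, n = k + 2 := ⟨n - 2, by omega⟩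
      rw [show k + 2 - 2 = k by omega, show k + 2 + 1 - 2 = k + 1 by omega, Nat.choose_succ_succ' k 2]
      simp only [Nat.reduceAdd]
      omega

/-- Skeletons with `r ≤ n` among those of length `n + 1`. [cite: MadrasSlade1993, §4.2 (p. 94); lane plumbing] -/
theorem skels_succ_filter_r_le (n : ℕ) : (skels (n + 1)).filter (fun x => x.2.2 + 1 ≤ n + 1) = skels n := by
  ext x
  simp only [Finset.mem_filter, mem_skels]
  constructor
  · rintro ⟨⟨h1, h2, h3, -⟩, h4⟩; exact ⟨h1, h2, h3, by omega⟩
  · rintro ⟨h1, h2, h3, h4⟩; exact ⟨⟨h1, h2, h3, by omega⟩, by omega⟩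

/-- Skeletons with `p ≥ 2` are the shifts of the shorter skeletons (with a shift-stable side condition).
[cite: MadrasSlade1993, §4.2 (p. 94); lane plumbing] -/
theorem skels_succ_filter_two_le (n : ℕ) (P : ℕ × ℕ × ℕ → Prop) [DecidablePred P] :
    (skels (n + 1)).filter (fun x => 2 ≤ x.1 ∧ P x) =
      ((skels n).filter (fun y => P (y.1 + 1, y.2.1 + 1, y.2.2 + 1))).image (fun y => (y.1 + 1, y.2.1 + 1, y.2.2 + 1)) := by
  ext ⟨a, b, c⟩
  simp only [Finset.mem_filter, mem_skels, Finset.mem_image, Prod.mk.injEq]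
  constructor
  · rintro ⟨⟨h1, h2, h3, h4⟩, h5, hP⟩
    refine ⟨(a - 1, b - 1, c - 1), ⟨⟨?_, ?_, ?_, ?_⟩, ?_⟩, ?_, ?_, ?_⟩ <;> (try dsimp only) <;> (try omega)
    rwa [show a - 1 + 1 = a by omega, show b - 1 + 1 = b by omega, show c - 1 + 1 = c by omega]
  · rintro ⟨y, ⟨⟨h1, h2, h3, h4⟩, hP⟩, rfl, rfl, rfl⟩
    exact ⟨⟨by omega, by omega, by omega, by omega⟩, by omega, hP⟩

/-- The shift is injective (card version of the previous lemma). [cite: MadrasSlade1993, §4.2 (p. 94); lane plumbing] -/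
theorem card_skels_succ_filter_two_le (n : ℕ) (P : ℕ × ℕ × ℕ → Prop) [DecidablePred P] :
    ((skels (n + 1)).filter (fun x => 2 ≤ x.1 ∧ P x)).card =
      ((skels n).filter (fun y => P (y.1 + 1, y.2.1 + 1, y.2.2 + 1))).card := by
  rw [skels_succ_filter_two_le, Finset.card_image_of_injective]
  intro y y' h
  simp only [Prod.mk.injEq] at h
  exact Prod.ext (by omega) (Prod.ext (by omega) (by omega))

/-- `#{skeletons with q = p + 2} = C(n − 3, 2)`. [cite: MadrasSlade1993, §4.2 (p. 94); lane lemma] -/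
theorem card_skels_filter_q (n : ℕ) : ((skels n).filter (fun x => x.2.1 = x.1 + 2)).card = (n - 3).choose 2 := by
  have e : (skels n).filter (fun x => x.2.1 = x.1 + 2) = (prs 4 n).image (fun y => (y.1, y.1 + 2, y.2)) := by
    ext ⟨a, b, c⟩
    simp only [Finset.mem_filter, mem_skels, Finset.mem_image, mem_prs, Prod.mk.injEq]
    constructor
    · rintro ⟨⟨h1, h2, h3, h4⟩, h5⟩; exact ⟨(a, c), ⟨h1, by omega, h4⟩, rfl, by omega, rfl⟩
    · rintro ⟨y, ⟨h1, h2, h3⟩, rfl, rfl, rfl⟩; exact ⟨⟨h1, le_rfl, by omega, h3⟩, rfl⟩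
  rw [e, Finset.card_image_of_injective _ (fun y y' h => by simp only [Prod.mk.injEq] at h; exact Prod.ext h.1 h.2.2),
    card_prs (by omega), show n + 1 - 4 = n - 3 by omega]

/-- `#{skeletons with r = q + 2} = C(n − 3, 2)`. [cite: MadrasSlade1993, §4.2 (p. 94); lane lemma] -/
theorem card_skels_filter_r (n : ℕ) : ((skels n).filter (fun x => x.2.2 = x.2.1 + 2)).card = (n - 3).choose 2 := by
  have e : (skels n).filter (fun x => x.2.2 = x.2.1 + 2) = (prs 2 (n - 2)).image (fun y => (y.1, y.2, y.2 + 2)) := by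
    ext ⟨a, b, c⟩
    simp only [Finset.mem_filter, mem_skels, Finset.mem_image, mem_prs, Prod.mk.injEq]
    constructor
    · rintro ⟨⟨h1, h2, h3, h4⟩, h5⟩; exact ⟨(a, b), ⟨h1, h2, by omega⟩, rfl, rfl, by omega⟩
    · rintro ⟨y, ⟨h1, h2, h3⟩, rfl, rfl, rfl⟩; exact ⟨⟨h1, h2, le_rfl, by omega⟩, rfl⟩
  rw [e, Finset.card_image_of_injective _ (fun y y' h => by simp only [Prod.mk.injEq] at h; exact Prod.ext h.1 h.2.1),
    card_prs (by omega), show n - 2 + 1 - 2 = n - 3 by omega]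

/-- `#{skeletons with q = p + 2 and r = q + 2} = n − 4`. [cite: MadrasSlade1993, §4.2 (p. 94); lane lemma] -/
theorem card_skels_filter_qr (n : ℕ) :
    ((skels n).filter (fun x => x.2.1 = x.1 + 2 ∧ x.2.2 = x.2.1 + 2)).card = n - 4 := by
  have e : (skels n).filter (fun x => x.2.1 = x.1 + 2 ∧ x.2.2 = x.2.1 + 2) =
      (Finset.Icc 1 (n - 4)).image (fun a => (a, a + 2, a + 4)) := by
    ext ⟨a, b, c⟩
    simp only [Finset.mem_filter, mem_skels, Finset.mem_image, Finset.mem_Icc, Prod.mk.injEq]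
    constructor
    · rintro ⟨⟨h1, h2, h3, h4⟩, h5, h6⟩; exact ⟨a, ⟨h1, by omega⟩, rfl, by omega, by omega⟩
    · rintro ⟨a', ⟨h1, h2⟩, rfl, rfl, rfl⟩; exact ⟨⟨h1, le_rfl, le_rfl, by omega⟩, rfl, rfl⟩
  rw [e, Finset.card_image_of_injective _ (fun y y' h => by simp only [Prod.mk.injEq] at h; exact h.1), Nat.card_Icc]
  omega

/-- Position `1` never has a source. [cite: MadrasSlade1993, §4.2 (p. 94); lane plumbing] -/
theorem src_one {p q r : ℕ} (hadm : 1 ≤ p ∧ p + 2 ≤ q ∧ q + 2 ≤ r) : src p q r 1 = none := by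
  unfold src
  rw [if_neg (by omega), if_neg (by omega), if_neg (by omega), if_neg (by omega)]

/-- Position `p + 1` has a source iff `q = p + 2` and `p ≥ 2`. [cite: MadrasSlade1993, §4.2 (p. 94); lane plumbing] -/
theorem src_p_succ_eq_none_iff {p q r : ℕ} (hadm : 1 ≤ p ∧ p + 2 ≤ q ∧ q + 2 ≤ r) :
    src p q r (p + 1) = none ↔ ¬ (q = p + 2 ∧ 2 ≤ p) := by
  unfold src
  rw [if_neg (by omega)]
  by_cases h : q = p + 2 ∧ 2 ≤ p
  · rw [if_pos ⟨rfl, h⟩]; simp [h]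
  · rw [if_neg (by tauto), if_neg (by omega), if_neg (by omega)]; simp [h]

/-- Position `q + 1` has a source iff `q = p + 2` or `r = q + 2`. [cite: MadrasSlade1993, §4.2 (p. 94); lane plumbing] -/
theorem src_q_succ_eq_none_iff {p q r : ℕ} (hadm : 1 ≤ p ∧ p + 2 ≤ q ∧ q + 2 ≤ r) :
    src p q r (q + 1) = none ↔ ¬ (q = p + 2 ∨ r = q + 2) := by
  unfold src
  rw [if_neg (by omega), if_neg (by omega)]
  by_cases h : q = p + 2 ∨ r = q + 2
  · rw [if_pos ⟨rfl, h⟩]; simp [h]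
  · rw [if_neg (by tauto), if_neg (by omega)]; simp [h]

/-- Position `r + 1` has a source iff `r = q + 2`. [cite: MadrasSlade1993, §4.2 (p. 94); lane plumbing] -/
theorem src_r_succ_eq_none_iff {p q r : ℕ} (hadm : 1 ≤ p ∧ p + 2 ≤ q ∧ q + 2 ≤ r) :
    src p q r (r + 1) = none ↔ r ≠ q + 2 := by
  unfold src
  rw [if_neg (by omega), if_neg (by omega), if_neg (by omega)]
  by_cases h : r = q + 2
  · rw [if_pos ⟨rfl, h⟩]; simp [h]
  · rw [if_neg (by tauto)]; simp [h]

/-- ★ THE NUMBER OF CONSTRAINED LATERAL POSITIONS OF A SKELETON: of the `n − 3` lateral positions exactly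
`[p ≥ 2] + [¬(q = p+2 ∧ p ≥ 2)] + [¬(q = p+2 ∨ r = q+2)] + [r + 1 ≤ n ∧ r ≠ q + 2]` (positions `1`, `p+1`, `q+1`, `r+1`) have no source.
[cite: MadrasSlade1993, §4.2 (p. 94); lane lemma] -/
theorem bCount_add_free {n p q r : ℕ} (hadm : 1 ≤ p ∧ p + 2 ≤ q ∧ q + 2 ≤ r ∧ r ≤ n) :
    bCount n p q r + ((if 2 ≤ p then 1 else 0) + ((if ¬ (q = p + 2 ∧ 2 ≤ p) then 1 else 0) +
      ((if ¬ (q = p + 2 ∨ r = q + 2) then 1 else 0) + (if r + 1 ≤ n ∧ r ≠ q + 2 then 1 else 0)))) = n - 3 := by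
  have hadm3 : 1 ≤ p ∧ p + 2 ≤ q ∧ q + 2 ≤ r := ⟨hadm.1, hadm.2.1, hadm.2.2.1⟩
  set L : Finset ℕ := (Finset.range (n + 1)).filter (fun t => t ≠ 0 ∧ ¬ IsVert p q r t) with hLdef
  have hmemL : ∀ t, t ∈ L ↔ t ≤ n ∧ t ≠ 0 ∧ t ≠ p ∧ t ≠ q ∧ t ≠ r := by
    intro t
    rw [hLdef, Finset.mem_filter, Finset.mem_range]
    simp only [IsVert, not_or]
    constructor
    · rintro ⟨h1, h2, h3, h4, h5⟩; exact ⟨by omega, h2, h3, h4, h5⟩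
    · rintro ⟨h1, h2, h3, h4, h5⟩; exact ⟨by omega, h2, h3, h4, h5⟩
  -- `#L = n − 3`
  have hL : L.card = n - 3 := by
    have e : L = Finset.range (n + 1) \ ({0, p, q, r} : Finset ℕ) := by
      ext t
      rw [hmemL, Finset.mem_sdiff, Finset.mem_range]
      simp only [Finset.mem_insert, Finset.mem_singleton, not_or]
      constructor
      · rintro ⟨h1, h2, h3, h4, h5⟩; exact ⟨by omega, h2, h3, h4, h5⟩
      · rintro ⟨h1, h2, h3, h4, h5⟩; exact ⟨by omega, h2, h3, h4, h5⟩
    have hsub : ({0, p, q, r} : Finset ℕ) ⊆ Finset.range (n + 1) := by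
      intro t ht
      simp only [Finset.mem_insert, Finset.mem_singleton] at ht
      rw [Finset.mem_range]; omega
    have h4 : ({0, p, q, r} : Finset ℕ).card = 4 := by
      rw [Finset.card_insert_of_notMem (by simp only [Finset.mem_insert, Finset.mem_singleton]; omega),
        Finset.card_insert_of_notMem (by simp only [Finset.mem_insert, Finset.mem_singleton]; omega),
        Finset.card_insert_of_notMem (by simp only [Finset.mem_singleton]; omega), Finset.card_singleton]
    rw [e, Finset.card_sdiff_of_subset hsub, Finset.card_range, h4]; omega
  -- `bCount + #free = #L`
  have hsplit : bCount n p q r + (L.filter (fun t => src p q r t = none)).card = L.card := by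
    have e1 : (Finset.range (n + 1)).filter (fun t => t ≠ 0 ∧ ¬ IsVert p q r t ∧ src p q r t ≠ none) =
        L.filter (fun t => ¬ src p q r t = none) := by
      rw [hLdef, Finset.filter_filter]
      exact Finset.filter_congr fun t _ => by simp only [ne_eq, and_assoc]
    unfold bCount
    rw [e1, add_comm]
    exact Finset.card_filter_add_card_filter_not _
  -- the free positions
  have hfree : (L.filter (fun t => src p q r t = none)).card = (if 2 ≤ p then 1 else 0) +
      ((if ¬ (q = p + 2 ∧ 2 ≤ p) then 1 else 0) + ((if ¬ (q = p + 2 ∨ r = q + 2) then 1 else 0) +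
        (if r + 1 ≤ n ∧ r ≠ q + 2 then 1 else 0))) := by
    have hS : L.filter (fun t => src p q r t = none) =
        ({1, p + 1, q + 1, r + 1} : Finset ℕ).filter (fun t => t ∈ L ∧ src p q r t = none) := by
      ext t
      simp only [Finset.mem_filter, Finset.mem_insert, Finset.mem_singleton]
      constructor
      · rintro ⟨htL, hsrc⟩
        refine ⟨?_, htL, hsrc⟩
        by_contra hne
        simp only [not_or] at hne
        obtain ⟨h1, h2, h3, h4, h5⟩ := (hmemL t).1 htL
        have hs := src_succ_of_lateral (p := p) (q := q) (r := r) (i := t - 1) (by omega) (by omega) (by omega) (by omega)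
        rw [show t - 1 + 1 = t by omega, hsrc] at hs
        exact absurd hs (by simp)
      · rintro ⟨-, htL, hsrc⟩; exact ⟨htL, hsrc⟩
    have i1 : (1 ∈ L ∧ src p q r 1 = none) ↔ 2 ≤ p := by
      rw [hmemL]; constructor
      · rintro ⟨⟨-, -, h, -⟩, -⟩; omega
      · intro h; exact ⟨⟨by omega, by omega, by omega, by omega, by omega⟩, src_one hadm3⟩
    have i2 : (p + 1 ∈ L ∧ src p q r (p + 1) = none) ↔ ¬ (q = p + 2 ∧ 2 ≤ p) := by
      rw [hmemL, src_p_succ_eq_none_iff hadm3]; constructor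
      · rintro ⟨-, h⟩; exact h
      · intro h; exact ⟨⟨by omega, by omega, by omega, by omega, by omega⟩, h⟩
    have i3 : (q + 1 ∈ L ∧ src p q r (q + 1) = none) ↔ ¬ (q = p + 2 ∨ r = q + 2) := by
      rw [hmemL, src_q_succ_eq_none_iff hadm3]; constructor
      · rintro ⟨-, h⟩; exact h
      · intro h; exact ⟨⟨by omega, by omega, by omega, by omega, by omega⟩, h⟩
    have i4 : (r + 1 ∈ L ∧ src p q r (r + 1) = none) ↔ (r + 1 ≤ n ∧ r ≠ q + 2) := by
      rw [hmemL, src_r_succ_eq_none_iff hadm3]; constructor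
      · rintro ⟨⟨h1, -⟩, h⟩; exact ⟨h1, h⟩
      · rintro ⟨h1, h⟩; exact ⟨⟨h1, by omega, by omega, by omega, by omega⟩, h⟩
    rw [hS, Finset.card_filter,
      Finset.sum_insert (by simp only [Finset.mem_insert, Finset.mem_singleton]; omega),
      Finset.sum_insert (by simp only [Finset.mem_insert, Finset.mem_singleton]; omega),
      Finset.sum_insert (by simp only [Finset.mem_singleton]; omega), Finset.sum_singleton]
    simp only [i1, i2, i3, i4]
  rw [← hL, ← hsplit, hfree]

/-- `C(a, 3)` as a rational number. [cite: MadrasSlade1993, §1.2 (p. 10); lane plumbing] -/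
theorem cast_choose_three (a : ℕ) : ((a.choose 3 : ℕ) : ℚ) = (a : ℚ) * ((a : ℚ) - 1) * ((a : ℚ) - 2) / 6 := by
  induction a with
  | zero => simp
  | succ a ih =>
    rw [Nat.choose_succ_succ' a 2, Nat.cast_add, ih, Nat.cast_choose_two]
    push_cast
    ring

/-- ★ THE FIRST SUM: `#skels(m + 4) = C(m + 2, 3) = (m+2)(m+1)m/6`. [cite: MadrasSlade1993, §4.2 (p. 94); lane lemma] -/
theorem card_skels_cast (m : ℕ) : ((skels (m + 4)).card : ℚ) = ((m : ℚ) + 2) * ((m : ℚ) + 1) * (m : ℚ) / 6 := by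
  rw [card_skels, show m + 4 - 2 = m + 2 by omega, cast_choose_three]
  push_cast
  ring

/-- ★ THE SECOND SUM: `Σ_{skels(m+4)} bCount = m²(m² − 1)/6 + 2m² − m` (`= 1, 8, 27, 68, 145, …`).
[cite: MadrasSlade1993, §4.2 (p. 94); lane lemma] -/
theorem sum_bCount_skels (m : ℕ) :
    ∑ x ∈ skels (m + 4), (bCount (m + 4) x.1 x.2.1 x.2.2 : ℚ) =
      (m : ℚ) ^ 2 * ((m : ℚ) ^ 2 - 1) / 6 + 2 * (m : ℚ) ^ 2 - (m : ℚ) := by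
  have hper : ∀ x ∈ skels (m + 4), (bCount (m + 4) x.1 x.2.1 x.2.2 : ℚ) = (((m + 4 - 3 : ℕ) : ℚ) -
      ((if 2 ≤ x.1 then 1 else 0) + ((if ¬ (x.2.1 = x.1 + 2 ∧ 2 ≤ x.1) then 1 else 0) +
        ((if ¬ (x.2.1 = x.1 + 2 ∨ x.2.2 = x.2.1 + 2) then 1 else 0) +
          (if x.2.2 + 1 ≤ m + 4 ∧ x.2.2 ≠ x.2.1 + 2 then 1 else 0))))) := by
    intro x hx
    have h := bCount_add_free (mem_skels.1 hx)
    rw [eq_sub_iff_add_eq]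
    exact_mod_cast h
  -- the five filtered counts
  have cS : ((skels (m + 4)).card : ℚ) = (((m + 2).choose 3 : ℕ) : ℚ) := by
    rw [card_skels, show m + 4 - 2 = m + 2 by omega]
  have cA : (((skels (m + 4)).filter (fun x => 2 ≤ x.1)).card : ℚ) = (((m + 1).choose 3 : ℕ) : ℚ) := by
    have h := card_skels_succ_filter_two_le (m + 3) (fun _ => True)
    rw [Finset.filter_true_of_mem (fun _ _ => trivial), card_skels, show m + 3 - 2 = m + 1 by omega] at h
    rw [← h]
    congr 2
    exact Finset.filter_congr fun x _ => by simp
  have cB' : (((skels (m + 4)).filter (fun x => x.2.1 = x.1 + 2 ∧ 2 ≤ x.1)).card : ℚ) = ((m.choose 2 : ℕ) : ℚ) := by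
    have h := card_skels_succ_filter_two_le (m + 3) (fun x => x.2.1 = x.1 + 2)
    have h' : ((skels (m + 3)).filter (fun y : ℕ × ℕ × ℕ => y.2.1 + 1 = y.1 + 1 + 2)).card = m.choose 2 := by
      rw [← show m + 3 - 3 = m by omega, ← card_skels_filter_q (m + 3)]
      congr 1
      exact Finset.filter_congr fun y _ => by omega
    rw [h'] at h
    rw [← h]
    congr 2
    exact Finset.filter_congr fun x _ => by tauto
  have cOr : (((skels (m + 4)).filter (fun x => x.2.1 = x.1 + 2 ∨ x.2.2 = x.2.1 + 2)).card : ℚ) =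
      (((m + 1).choose 2 : ℕ) : ℚ) + (((m + 1).choose 2 : ℕ) : ℚ) - (m : ℚ) := by
    have h := Finset.card_union_add_card_inter ((skels (m + 4)).filter (fun x => x.2.1 = x.1 + 2))
      ((skels (m + 4)).filter (fun x => x.2.2 = x.2.1 + 2))
    rw [← Finset.filter_or, ← Finset.filter_and, card_skels_filter_q, card_skels_filter_r, card_skels_filter_qr,
      show m + 4 - 3 = m + 1 by omega, show m + 4 - 4 = m by omega] at h
    rw [eq_sub_iff_add_eq]
    exact_mod_cast h
  have c4 : (((skels (m + 4)).filter (fun x => x.2.2 + 1 ≤ m + 4 ∧ x.2.2 ≠ x.2.1 + 2)).card : ℚ) =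
      (((m + 1).choose 3 : ℕ) : ℚ) - ((m.choose 2 : ℕ) : ℚ) := by
    rw [← Finset.filter_filter, skels_succ_filter_r_le (m + 3)]
    have h := Finset.card_filter_add_card_filter_not (s := skels (m + 3)) (fun x => x.2.2 = x.2.1 + 2)
    rw [card_skels_filter_r, card_skels, show m + 3 - 3 = m by omega, show m + 3 - 2 = m + 1 by omega] at h
    rw [eq_sub_iff_add_eq, add_comm]
    exact_mod_cast h
  -- complements
  have cB'c : (((skels (m + 4)).filter (fun x => ¬ (x.2.1 = x.1 + 2 ∧ 2 ≤ x.1))).card : ℚ) =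
      (((m + 2).choose 3 : ℕ) : ℚ) - ((m.choose 2 : ℕ) : ℚ) := by
    have h := Finset.card_filter_add_card_filter_not (s := skels (m + 4)) (fun x => x.2.1 = x.1 + 2 ∧ 2 ≤ x.1)
    rw [card_skels, show m + 4 - 2 = m + 2 by omega] at h
    rw [← cB', eq_sub_iff_add_eq, add_comm]
    exact_mod_cast h
  have cOrc : (((skels (m + 4)).filter (fun x => ¬ (x.2.1 = x.1 + 2 ∨ x.2.2 = x.2.1 + 2))).card : ℚ) =
      (((m + 2).choose 3 : ℕ) : ℚ) - ((((m + 1).choose 2 : ℕ) : ℚ) + (((m + 1).choose 2 : ℕ) : ℚ) - (m : ℚ)) := by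
    have h := Finset.card_filter_add_card_filter_not (s := skels (m + 4)) (fun x => x.2.1 = x.1 + 2 ∨ x.2.2 = x.2.1 + 2)
    rw [card_skels, show m + 4 - 2 = m + 2 by omega] at h
    rw [← cOr, eq_sub_iff_add_eq, add_comm]
    exact_mod_cast h
  rw [Finset.sum_congr rfl hper, Finset.sum_sub_distrib, Finset.sum_const, nsmul_eq_mul, Finset.sum_add_distrib,
    Finset.sum_add_distrib, Finset.sum_add_distrib, Finset.sum_boole, Finset.sum_boole, Finset.sum_boole, Finset.sum_boole,
    cS, cA, cB'c, cOrc, c4, show m + 4 - 3 = m + 1 by omega, cast_choose_three, cast_choose_three, Nat.cast_choose_two,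
    Nat.cast_choose_two]
  push_cast
  ring

end SkeletonSums

end WordTypes

section CensusLawL2

open WordTypes

/-- ★★★ THE CENSUS LAW (L2′) OF THE SPAN-TWO CELL, SECOND AXIS CLASS: for every `m ≥ 1` (`c = m + 3`), the number of cost-`c`,
length-`c + 2` irreducible bridges of `ℤ^{m+1}` using every lateral axis is
`F_{c,c+2}(c−3) = (c−3)!·2^{c−3}·(c⁵ − 12c⁴ + 59c³ − 162c² + 276c − 234)/6` (`= 2, 128, 4464, 127488, …`) — literally hypothesis `hF`
of `exists_polynomial_largeForceCoeffZd_thirdCoeff_of_bridge_count`: rigidity (skeleton words), the planted-skeleton polynomial, the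
falling-factorial extraction, and the two binomial sums over skeletons.
[cite: MadrasSlade1993, §4.2 eq. (4.2.20)–(4.2.22) (p. 94); §1.1 eq. (1.1.8) p. 5; lane theorem] -/
theorem card_irreducibleBridges_spanTwo_secondClass (m : ℕ) (hm : 1 ≤ m) :
    (((irreducibleBridges (m + 1) (m + 5)).filter fun (ω : ℕ → Site (m + 1)) => costZd m (m + 5) ω = m + 3 ∧
        ∀ a : Fin (m + 1), a ≠ 0 → ∃ i ≤ m + 5, ω i a ≠ (0 : ℤ)).card : ℚ) =
      (m.factorial : ℚ) * 2 ^ m * ((((m : ℚ) + 3) ^ 5 - 12 * ((m : ℚ) + 3) ^ 4 + 59 * ((m : ℚ) + 3) ^ 3 -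
        162 * ((m : ℚ) + 3) ^ 2 + 276 * ((m : ℚ) + 3) - 234) / 6) := by
  have h := axisClassCard_second_eq_skeleton_sums (c := m + 3) (n := m + 4) (by omega) (by omega)
  rw [show m + 3 - 3 = m by omega, show m + 4 - 3 = m + 1 by omega, show m + 4 - 2 = m + 2 by omega,
    show m + 4 + 1 = m + 5 by omega] at h
  rw [Finset.sum_add_distrib, Finset.sum_const, nsmul_eq_mul, sum_bCount_skels, card_skels_cast, Nat.cast_choose_two] at h
  have hm0 : (m.factorial : ℚ) ≠ 0 := by positivity
  rw [div_eq_iff hm0] at h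
  push_cast at h
  change (axisClassCard (m + 3) (m + 5) m : ℚ) = _
  linear_combination h / 2

/-- ★★★ AMENDMENT BC, UNCONDITIONAL — THE FOURTH SYMBOL OF THE `1/d` EXPANSION: for every `k ≥ 3` the coefficient `c_k^{(d)}` of the
pulled large-force expansion on `ℤ^d` is a polynomial in `d` of degree `k − 1` with
`[d^{k−1}] = (−2)^{k−1}`, `[d^{k−2}] = (−1)^{k−1} 2^{k−2} (k² − 5k + 7)` and
`[d^{k−3}] c_k^{(d)} = (−1)^{k−1} 2^{k−3} (k−3)(k−4)(5k² − 35k + 56)/12` — the tree's conditional theorem with both census laws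
now proved ((L1): `card_badCanonical`; (L2′): `card_irreducibleBridges_spanTwo_secondClass`).
[cite: MadrasSlade1993, §1.2 (p. 10: the 1/d expansion of μ); §4.2 eq. (4.2.20)–(4.2.22); lane theorem (Amendment BC)] -/
theorem exists_polynomial_largeForceCoeffZd_thirdCoeff_law {k : ℕ} (hk : 3 ≤ k) :
    ∃ P : Polynomial ℚ, P.natDegree = k - 1 ∧ P.leadingCoeff = (-2 : ℚ) ^ (k - 1) ∧
      P.coeff (k - 2) = (-1 : ℚ) ^ (k - 1) * 2 ^ (k - 2) * ((k : ℚ) ^ 2 - 5 * k + 7) ∧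
      P.coeff (k - 3) = (-1 : ℚ) ^ (k - 1) * 2 ^ (k - 3) * (((k : ℚ) - 3) * ((k : ℚ) - 4) * (5 * (k : ℚ) ^ 2 - 35 * (k : ℚ) + 56)) / 12 ∧
      ∀ d : ℕ, (largeForceCoeffZd d k : ℚ) = P.eval (d : ℚ) :=
  exists_polynomial_largeForceCoeffZd_thirdCoeff_of_bridge_count card_irreducibleBridges_spanTwo_secondClass hk

end CensusLawL2

end Literature.Probability.RandomPlanarGeometry.SAW.Zd

end
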